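import Literature.AlgebraicGeometry.Motives.KunnethSections
import Literature.AlgebraicGeometry.Morphisms.CechH1PullbackComp
import Mathlib.LinearAlgebra.TensorProduct.Pi
import HarnessLib

/-!
# Künneth in degree zero on finite product families: `(Π_a Γ(V_a)) ⊗_k (Π_b Γ(W_b)) ⥲ Č⁰(𝒫, 𝒪)`

`Motives/KunnethSections` proves that for `k`-schemes `X`, `Y` and affine (more generally qcqs)
opens `V ⊆ X`, `W ⊆ Y` the Künneth map on sections
`kunnethSections X Y V W : Γ(V) ⊗_k Γ(W) → Γ(V ×_k W)`, `r ⊗ s ↦ pr_X^*(r) · pr_Y^*(s)`, is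
bijective (Görtz–Wedhorn II, Cor. 22.110 in degree `0`; Görtz–Wedhorn I, Prop. 4.17 for affines).
This file assembles the finite-product version needed to identify the terms of the Čech complex
of a product covering `𝒫 = (V_a ×_k W_b)_{(a,b)}` (`productFamily` of
`Motives/KunnethH1ProductCover`) with tensor products of the terms of the Čech complexes of
`(V_a)` and `(W_b)`:

* `kunnethSectionsPi X Y V W : (Π_a Γ(V_a)) ⊗_k (Π_b Γ(W_b)) → Č⁰(𝒫, 𝒪_{X ×_k Y})`,
  `r ⊗ s ↦ (pr_X^*(r_a) · pr_Y^*(s_b))_{(a,b)}` (`kunnethSectionsPi_tmul`), and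
  `kunnethSectionsPi_bijective` — **bijective for finite families of affine opens** (termwise
  `kunnethSections_bijective_of_isAffineOpen`; finite products commute with `⊗_k`, Mathlib
  `TensorProduct.piLeft`, `TensorProduct.piRight`);
* restriction compatibilities on pure tensors (`res_comapFst`, `res_comapSnd`,
  `res_kunnethSections_tmul`) and `Sections.comap_congr` (transport of `g^*` along `g = g'`).

Everything here is proved; it is used in `Motives/KunnethH1ProductCoverProofs` (Künneth
injectivity for `Ȟ¹` on a product covering, Görtz–Wedhorn II, proof of Thm. 24.73).
Mathlib searched (pin): `TensorProduct.piLeft`, `TensorProduct.piRight`,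
`TensorProduct.piRightHom_tmul`, `LinearEquiv.piCongrRight`, `LinearEquiv.ofBijective`,
`TensorProduct.ext'` (used).

## References

* U. Görtz, T. Wedhorn, *Algebraic Geometry II: Cohomology of Schemes*, Springer Spektrum (2023),
  doi:10.1007/978-3-658-43031-3: Cor. 22.110; Thm. 24.73 and its proof (read via the held copy,
  text chunks 0399, 0550). [GortzWedhorn2023]
* U. Görtz, T. Wedhorn, *Algebraic Geometry I: Schemes*, 2nd ed. (2020),
  doi:10.1007/978-3-658-30733-2: Prop. 4.17 (`Spec A ×_{Spec R} Spec B = Spec (A ⊗_R B)`; read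
  via the held copy, text chunk 0127). [GortzWedhorn2020]
-/

universe u v w

open CategoryTheory CategoryTheory.Limits AlgebraicGeometry MonoidalCategory TensorProduct
open CartesianMonoidalCategory TopologicalSpace Opposite
open Literature.AlgebraicGeometry.Morphisms

noncomputable section

/-! ### Transport of `g^*` along an equality of morphisms -/

namespace Literature.AlgebraicGeometry.Morphisms.Sections

variable {A : Type u} [CommRing A] {X Y : Scheme.{u}} {fX : X ⟶ Spec (.of A)}
  {fY : Y ⟶ Spec (.of A)}

/-- `comap` along equal morphisms agree. [folklore] -/
theorem comap_congr {g g' : Y ⟶ X} (H : g = g') (hg : g ≫ fX = fY) (hg' : g' ≫ fX = fY)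
    {V : X.Opens} {W : Y.Opens} (e : W ≤ g ⁻¹ᵁ V) (e' : W ≤ g' ⁻¹ᵁ V) (s : Sections fX V) :
    comap fX fY g hg e s = comap fX fY g' hg' e' s := by
  subst H
  rfl

end Literature.AlgebraicGeometry.Morphisms.Sections

namespace Literature.AlgebraicGeometry.Motives

variable {k : Type u} [Field k] (X Y : SchemeOver k)

/-! ### Restriction to smaller product opens -/

/-- Restriction to a smaller product open commutes with `pr_X^*`. [folklore] -/
theorem res_comapFst {V V' : X.left.Opens} {W W' : Y.left.Opens} (hV : V' ≤ V)
    (h : prodOpen X Y V' W' ≤ prodOpen X Y V W) (r : Sections X.hom V) :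
    Sections.res (X ⊗ Y).hom h (comapFst X Y V W r) =
      comapFst X Y V' W' (Sections.res X.hom hV r) := by
  rw [Sections.res_comap, Sections.comap_res]

/-- Restriction to a smaller product open commutes with `pr_Y^*`. [folklore] -/
theorem res_comapSnd {V V' : X.left.Opens} {W W' : Y.left.Opens} (hW : W' ≤ W)
    (h : prodOpen X Y V' W' ≤ prodOpen X Y V W) (s : Sections Y.hom W) :
    Sections.res (X ⊗ Y).hom h (comapSnd X Y V W s) =
      comapSnd X Y V' W' (Sections.res Y.hom hW s) := by
  rw [Sections.res_comap, Sections.comap_res]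

/-- Restriction of the Künneth map on pure tensors:
`(pr_X^* r · pr_Y^* s)|_{V' × W'} = pr_X^*(r|_{V'}) · pr_Y^*(s|_{W'})`. [folklore] -/
theorem res_kunnethSections_tmul {V V' : X.left.Opens} {W W' : Y.left.Opens} (hV : V' ≤ V)
    (hW : W' ≤ W) (h : prodOpen X Y V' W' ≤ prodOpen X Y V W) (r : Sections X.hom V)
    (s : Sections Y.hom W) :
    Sections.res (X ⊗ Y).hom h (kunnethSections X Y V W (r ⊗ₜ s)) =
      kunnethSections X Y V' W' (Sections.res X.hom hV r ⊗ₜ Sections.res Y.hom hW s) := by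
  rw [kunnethSections_tmul, kunnethSections_tmul, map_mul, res_comapFst X Y hV h,
    res_comapSnd X Y hW h]

/-! ### Finite products: `(Π_a Γ(V_a)) ⊗_k (Π_b Γ(W_b)) → Π_{(a,b)} Γ(V_a ×_k W_b)` -/

section Pi

variable {A : Type v} {B : Type w} (V : A → X.left.Opens) (W : B → Y.left.Opens)

/-- **The Künneth map on Čech `0`-cochains of the product covering**:
`(Π_a Γ(V_a)) ⊗_k (Π_b Γ(W_b)) → Č⁰(𝒫, 𝒪_{X ×_k Y}) = Π_{(a,b)} Γ(V_a ×_k W_b)`,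
`r ⊗ s ↦ (pr_X^*(r_a) · pr_Y^*(s_b))_{(a,b)}` (Görtz–Wedhorn II, (22.23) termwise).
[cite: GortzWedhorn2023, (22.23) and Cor. 22.110] -/
def kunnethSectionsPi :
    (Π a, Sections X.hom (V a)) ⊗[k] (Π b, Sections Y.hom (W b)) →ₗ[k]
      CechC0 (X ⊗ Y).hom (productFamily X Y V W) :=
  LinearMap.pi fun p => (kunnethSections X Y (V p.1) (W p.2)).toLinearMap ∘ₗ
    TensorProduct.map (LinearMap.proj p.1) (LinearMap.proj p.2)

/-- `kunnethSectionsPi (r ⊗ s) (a, b) = pr_X^*(r_a) · pr_Y^*(s_b)`. [folklore] -/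
@[simp]
theorem kunnethSectionsPi_tmul (r : Π a, Sections X.hom (V a)) (s : Π b, Sections Y.hom (W b))
    (p : A × B) :
    kunnethSectionsPi X Y V W (r ⊗ₜ s) p =
      comapFst X Y (V p.1) (W p.2) (r p.1) * comapSnd X Y (V p.1) (W p.2) (s p.2) :=
  rfl

/-- Uncurrying `Π_a Π_b M a b ≅ Π_{(a,b)} M a b`, `k`-linearly. [folklore] -/
def piProdUncurry (M : A → B → Type*) [∀ a b, AddCommMonoid (M a b)]
    [∀ a b, Module k (M a b)] : (Π a b, M a b) ≃ₗ[k] Π p : A × B, M p.1 p.2 where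
  toFun m p := m p.1 p.2
  invFun m a b := m (a, b)
  map_add' _ _ := rfl
  map_smul' _ _ := rfl
  left_inv _ := rfl
  right_inv _ := rfl

/-- **`(Π_a Γ(V_a)) ⊗_k (Π_b Γ(W_b)) ⥲ Π_{(a,b)} Γ(V_a ×_k W_b)` for finite families of affine
opens** (`kunnethSections_bijective_of_isAffineOpen` termwise — Görtz–Wedhorn I, Prop. 4.17 /
II, Cor. 22.110 in degree `0`; finite products commute with `⊗_k`, Mathlib
`TensorProduct.piLeft`, `TensorProduct.piRight`). [cite: GortzWedhorn2023, Cor. 22.110, i = 0] -/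
theorem kunnethSectionsPi_bijective [Finite A] [Finite B] (hV : ∀ a, IsAffineOpen (V a))
    (hW : ∀ b, IsAffineOpen (W b)) : Function.Bijective (kunnethSectionsPi X Y V W) := by
  classical
  cases nonempty_fintype A
  cases nonempty_fintype B
  let T : ∀ p : A × B, Sections X.hom (V p.1) ⊗[k] Sections Y.hom (W p.2) ≃ₗ[k]
      Sections (X ⊗ Y).hom (productFamily X Y V W p) := fun p =>
    LinearEquiv.ofBijective (kunnethSections X Y (V p.1) (W p.2)).toLinearMap
      (kunnethSections_bijective_of_isAffineOpen X Y (hV p.1) (hW p.2))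
  let E : (Π a, Sections X.hom (V a)) ⊗[k] (Π b, Sections Y.hom (W b)) ≃ₗ[k]
      CechC0 (X ⊗ Y).hom (productFamily X Y V W) :=
    TensorProduct.piLeft k (Π b, Sections Y.hom (W b)) (fun a => Sections X.hom (V a)) ≪≫ₗ
      LinearEquiv.piCongrRight
        (fun a => TensorProduct.piRight k k (Sections X.hom (V a)) fun b => Sections Y.hom (W b))
        ≪≫ₗ piProdUncurry (k := k) (fun a b => Sections X.hom (V a) ⊗[k] Sections Y.hom (W b))
        ≪≫ₗ LinearEquiv.piCongrRight T
  have hE : kunnethSectionsPi X Y V W = E.toLinearMap := by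
    apply TensorProduct.ext'
    intro r s
    funext p
    rw [kunnethSectionsPi_tmul]
    simp only [E, T, LinearEquiv.coe_coe, LinearEquiv.trans_apply, TensorProduct.piLeft,
      TensorProduct.comm_tmul, TensorProduct.piRight_apply, TensorProduct.piRightHom_tmul,
      LinearEquiv.piCongrRight_apply]
    rfl
  rw [hE]
  exact E.bijective

/-- Surjectivity form: every Čech `0`-cochain of the product covering of finite affine families is
in the image of the Künneth map. [folklore] -/
theorem kunnethSectionsPi_surjective [Finite A] [Finite B] (hV : ∀ a, IsAffineOpen (V a))
    (hW : ∀ b, IsAffineOpen (W b)) : Function.Surjective (kunnethSectionsPi X Y V W) :=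
  (kunnethSectionsPi_bijective X Y V W hV hW).surjective

/-- Injectivity form. [folklore] -/
theorem kunnethSectionsPi_injective [Finite A] [Finite B] (hV : ∀ a, IsAffineOpen (V a))
    (hW : ∀ b, IsAffineOpen (W b)) : Function.Injective (kunnethSectionsPi X Y V W) :=
  (kunnethSectionsPi_bijective X Y V W hV hW).injective

end Pi

end Literature.AlgebraicGeometry.Motives

end
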